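import Summits.Ventures.PercRepro.S2ThirteenNine
import Summits.Ventures.PercRepro.S2TwelveNineK1Cf
import Summits.Ventures.PercRepro.S2ElevenNineK2All

/-!
# PercRepro — S2: THE CELL `(13, 9)` IS A THEOREM (p7, gen 19; sub-claim S2; the fourth cell of the row `p = 13`)

**`c025_core_five_thirteen_nine`**: `RLS M 13 5` on every `e`-free core of rank `13` on `22` points — the double coloop split
(S2ThirteenNine) with the coloop-free cell `(13, 9)` (`c025_thirteen_nine_cf`), the scaled coloop-free cell `(12, 9)` at `K₁`
(`c025_twelve_nine_cfk1`, S2TwelveNineK1Cf) and the twice-scaled cell `(11, 9)` at `K₂` (`c025_eleven_nine_k2`, S2ElevenNineK2All), each by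
the nested dichotomy `ν = 8 → 7 → 6 → 5 → 4 → spread`. No window move is claimed (the lead's). Axioms: standard.
-/

open scoped Matroid

namespace PercRepro

namespace ThmN

open Set

variable {α : Type}

/-- **The cell `(13, 9)`**: `RLS M 13 5` on every `e`-free core of rank `13` on `22` points. -/
theorem c025_core_five_thirteen_nine (M : Matroid α) [M.Finite]
    (hR : M.eRank = ((13 : ℕ) : ℕ∞)) (hn : M.E.ncard = 13 + 9)
    (hfree : ∀ e ∈ M.E, ∃ A ⊆ M.E \ {e}, e ∉ M.closure A ∧ e ∉ M.closure ((M.E \ {e}) \ A)) : RLS M 13 5 :=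
  c025_core_five_thirteen_nine_of_subcells
    (fun M' _ hR' hn' hfree' hK' => c025_twelve_nine_cfk1 M' hR' hn' hfree' hK')
    (fun M' _ hR' hn' hfree' => c025_eleven_nine_k2 M' hR' hn' hfree') M hR hn hfree

end ThmN

end PercRepro
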